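/-
VALUE = THEOREM (plane geometry of `x^⊥` for the all-`p` reflection-class certificate), NOT summit
progress (cell b2b-lgcu-borel, gen 24); the crux item stmt-MatrixMultiplication-14079 is untouched.
-/
import Mathlib
import Literature.NumberTheory.EllipticCurves.BinaryQuarticDiscriminantFpCountProofs
import Summits.MatrixMultiplication.MatrixMultiplication.Theorems.SubgroupIdentityDesigns.Negative.ReflectionClassSphere

/-!
# The plane `x^⊥` of an anisotropic `x`: an explicit frame, Parseval, and reflections

VALUE = THEOREM (generic in the prime `p`), NOT summit progress; the crux item
stmt-MatrixMultiplication-14079 is untouched and remains open.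

Layer F6a of the all-`p` proof of the unified reflection-class certificate (ORACLE-g24 §G24-1 (S),
§G24-2): the toolkit for the SPLIT orbit sums.  For `x, ω ∈ 𝔽_p³` with `q = Q(x) ≠ 0` and
`Q₁ := Q(x × ω) = q Q(ω) − (x·ω)² ≠ 0` the vectors

  `w₁ = x × ω`,  `w₂ = x × w₁ = (x·ω) x − q ω`

form an orthogonal frame of the plane `W = x^⊥` with `Q(w₂) = q Q₁`, `ω ⊥ w₁`:
* `expand` — every `z ⊥ x` is `(z·w₁/Q₁) w₁ + (z·w₂/Q(w₂)) w₂`;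
* `sum_plane` — `Σ_{z ⊥ x} F z = Σ_{u,v} F (u w₁ + v w₂)`;
* `triple_sq` — the Gram identity `((x × ω)·v)² = det Gram(x, ω, v)`;
* `refl_apply`, `refl_dot_self`, `refl_dot_of_perp` — the reflection `R_z v = v − (2(z·v)/Q z) z`
  (`NonsquareReflections.reflMat`) is an isometry for `Q z ≠ 0` and preserves `v·x` for `z ⊥ x`.
HONEST SCOPE.  Toolkit only; by itself it excludes nothing.
-/

set_option linter.dupNamespace false

open scoped BigOperators Matrix

namespace Summit.MatrixMultiplication.MatrixMultiplication.Theorems.SubgroupIdentityDesigns.Negative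
namespace ReflectionClassPlane

open ReflectionClassCertificate (V)
open NonsquareReflections (reflMat)
open ReflectionClassSphere (exists_smul_of_cross_eq_zero)
open Literature.NumberTheory.EllipticCurves.BinaryQuartic (two_ne_zero_zmod)

variable {p : ℕ} [hp : Fact p.Prime]

/-! ## The frame -/

/-- First frame vector `w₁ = x × ω` of the plane `x^⊥`. -/
def w₁ (x ω : V p) : V p := x ⨯₃ ω

/-- Second frame vector `w₂ = x × w₁ = (x·ω) x − (x·x) ω`. -/
def w₂ (x ω : V p) : V p := x ⨯₃ (x ⨯₃ ω)

section Frame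

variable (x ω : V p)

/-- `w₁ ⊥ x`. -/
theorem w₁_dot_x : w₁ x ω ⬝ᵥ x = 0 := by rw [w₁, dotProduct_comm]; exact dot_self_cross x ω

/-- `w₁ ⊥ ω`. -/
theorem w₁_dot_ω : w₁ x ω ⬝ᵥ ω = 0 := by rw [w₁, dotProduct_comm]; exact dot_cross_self x ω

/-- `w₂ = (x·ω) x − (x·x) ω`. -/
theorem w₂_eq : w₂ x ω = (x ⬝ᵥ ω) • x - (x ⬝ᵥ x) • ω := by
  rw [w₂, cross_cross_eq_smul_sub_smul']

/-- `w₂·v = (x·ω)(x·v) − (x·x)(ω·v)`. -/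
theorem w₂_dot (v : V p) : w₂ x ω ⬝ᵥ v = (x ⬝ᵥ ω) * (x ⬝ᵥ v) - (x ⬝ᵥ x) * (ω ⬝ᵥ v) := by
  rw [w₂_eq, sub_dotProduct, smul_dotProduct, smul_dotProduct, smul_eq_mul, smul_eq_mul]

/-- `w₂ ⊥ x`. -/
theorem w₂_dot_x : w₂ x ω ⬝ᵥ x = 0 := by rw [w₂_dot, dotProduct_comm ω x]; ring

/-- `w₁ ⊥ w₂`. -/
theorem w₁_dot_w₂ : w₁ x ω ⬝ᵥ w₂ x ω = 0 := by
  simp only [w₁, w₂]; exact dot_cross_self x (x ⨯₃ ω)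

/-- `Q(w₁) = Q(x) Q(ω) − (x·ω)²`. -/
theorem w₁_dot_self : w₁ x ω ⬝ᵥ w₁ x ω = (x ⬝ᵥ x) * (ω ⬝ᵥ ω) - (x ⬝ᵥ ω) ^ 2 := by
  rw [w₁, cross_dot_cross, dotProduct_comm ω x]; ring

/-- `Q(w₂) = Q(x) Q(w₁)`. -/
theorem w₂_dot_self : w₂ x ω ⬝ᵥ w₂ x ω = (x ⬝ᵥ x) * (w₁ x ω ⬝ᵥ w₁ x ω) := by
  simp only [w₂, w₁]
  rw [cross_dot_cross, dot_self_cross]; ring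

/-- `w₂·ω = (x·ω)² − Q(x) Q(ω) = −Q(w₁)`. -/
theorem w₂_dot_ω : w₂ x ω ⬝ᵥ ω = -(w₁ x ω ⬝ᵥ w₁ x ω) := by
  rw [w₂_dot, w₁_dot_self]; ring

/-- **Gram identity**: `((x × ω)·v)²` is the Gram determinant of `(x, ω, v)`. -/
theorem triple_sq (v : V p) : (w₁ x ω ⬝ᵥ v) ^ 2 =
    (x ⬝ᵥ x) * (ω ⬝ᵥ ω) * (v ⬝ᵥ v) + 2 * (x ⬝ᵥ ω) * (ω ⬝ᵥ v) * (x ⬝ᵥ v)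
      - (x ⬝ᵥ x) * (ω ⬝ᵥ v) ^ 2 - (ω ⬝ᵥ ω) * (x ⬝ᵥ v) ^ 2 - (v ⬝ᵥ v) * (x ⬝ᵥ ω) ^ 2 := by
  simp only [w₁, cross_apply, dotProduct, Fin.sum_univ_three, Matrix.cons_val_zero,
    Matrix.cons_val_one, Matrix.cons_val_two, Matrix.head_cons, Matrix.tail_cons]
  ring

end Frame

/-! ## Expansion in the frame and sums over the plane -/

section Plane

variable {x ω : V p}

/-- The frame map `(u, v) ↦ u w₁ + v w₂`. -/
def frame (x ω : V p) (uv : ZMod p × ZMod p) : V p := uv.1 • w₁ x ω + uv.2 • w₂ x ω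

/-- `(u w₁ + v w₂)·w₁ = u Q(w₁)`. -/
theorem frame_dot_w₁ (uv : ZMod p × ZMod p) :
    frame x ω uv ⬝ᵥ w₁ x ω = uv.1 * (w₁ x ω ⬝ᵥ w₁ x ω) := by
  rw [frame, add_dotProduct, smul_dotProduct, smul_dotProduct, smul_eq_mul, smul_eq_mul,
    dotProduct_comm (w₂ x ω), w₁_dot_w₂, mul_zero, add_zero]

/-- `(u w₁ + v w₂)·w₂ = v Q(w₂)`. -/
theorem frame_dot_w₂ (uv : ZMod p × ZMod p) :
    frame x ω uv ⬝ᵥ w₂ x ω = uv.2 * (w₂ x ω ⬝ᵥ w₂ x ω) := by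
  rw [frame, add_dotProduct, smul_dotProduct, smul_dotProduct, smul_eq_mul, smul_eq_mul,
    w₁_dot_w₂, mul_zero, zero_add]

/-- `u w₁ + v w₂ ⊥ x`. -/
theorem frame_dot_x (uv : ZMod p × ZMod p) : frame x ω uv ⬝ᵥ x = 0 := by
  rw [frame, add_dotProduct, smul_dotProduct, smul_dotProduct, w₁_dot_x, w₂_dot_x, smul_zero,
    smul_zero, add_zero]

/-- **Expansion**: every `z ⊥ x` is `(z·w₁/Q(w₁)) w₁ + (z·w₂/Q(w₂)) w₂`
(`Q(x) ≠ 0`, `Q(w₁) ≠ 0`). -/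
theorem expand (hq : x ⬝ᵥ x ≠ 0) (hQ : w₁ x ω ⬝ᵥ w₁ x ω ≠ 0) {z : V p} (hz : z ⬝ᵥ x = 0) :
    z = frame x ω ((z ⬝ᵥ w₁ x ω) / (w₁ x ω ⬝ᵥ w₁ x ω), (z ⬝ᵥ w₂ x ω) / (w₂ x ω ⬝ᵥ w₂ x ω)) := by
  have hQ₂ : w₂ x ω ⬝ᵥ w₂ x ω ≠ 0 := by rw [w₂_dot_self]; exact mul_ne_zero hq hQ
  obtain ⟨d, hd⟩ : ∃ d : V p, d = z - frame x ω ((z ⬝ᵥ w₁ x ω) / (w₁ x ω ⬝ᵥ w₁ x ω),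
    (z ⬝ᵥ w₂ x ω) / (w₂ x ω ⬝ᵥ w₂ x ω)) := ⟨_, rfl⟩
  have hd1 : d ⬝ᵥ w₁ x ω = 0 := by
    rw [hd, sub_dotProduct, frame_dot_w₁]; field_simp; ring
  have hd2 : d ⬝ᵥ w₂ x ω = 0 := by
    rw [hd, sub_dotProduct, frame_dot_w₂]; field_simp; ring
  have hdx : d ⬝ᵥ x = 0 := by rw [hd, sub_dotProduct, frame_dot_x, hz, sub_zero]
  -- `d ⊥ w₁, w₂` forces `d ∥ w₁ × w₂ = Q(w₁) x`, and then `d ⊥ x` forces `d = 0`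
  have h12 : w₁ x ω ⨯₃ w₂ x ω = (w₁ x ω ⬝ᵥ w₁ x ω) • x := by
    show w₁ x ω ⨯₃ (x ⨯₃ w₁ x ω) = _
    rw [cross_cross_eq_smul_sub_smul', dotProduct_comm x (w₁ x ω), w₁_dot_x, zero_smul,
      sub_zero]
  have hcross : d ⨯₃ x = 0 := by
    have h1 : d ⨯₃ (w₁ x ω ⨯₃ w₂ x ω) = 0 := by
      rw [cross_cross_eq_smul_sub_smul', hd2, zero_smul, zero_sub, dotProduct_comm (w₁ x ω) d,
        hd1, zero_smul, neg_zero]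
    rw [h12, LinearMap.map_smul] at h1
    exact (smul_eq_zero.mp h1).resolve_left hQ
  by_contra hne
  have hd0 : d ≠ 0 := by
    intro h0; apply hne; rw [← sub_eq_zero, ← hd, h0]
  obtain ⟨a, ha⟩ := exists_smul_of_cross_eq_zero hd0 hcross
  apply hq
  nth_rewrite 1 [← ha]
  rw [smul_dotProduct, hdx, smul_zero]

/-- The frame map is injective (`Q(x) ≠ 0`, `Q(w₁) ≠ 0`). -/
theorem frame_injective (hq : x ⬝ᵥ x ≠ 0) (hQ : w₁ x ω ⬝ᵥ w₁ x ω ≠ 0) :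
    Function.Injective (frame x ω) := by
  have hQ₂ : w₂ x ω ⬝ᵥ w₂ x ω ≠ 0 := by rw [w₂_dot_self]; exact mul_ne_zero hq hQ
  intro a b h
  have h1 := congrArg (· ⬝ᵥ w₁ x ω) h
  have h2 := congrArg (· ⬝ᵥ w₂ x ω) h
  simp only [frame_dot_w₁, frame_dot_w₂] at h1 h2
  exact Prod.ext (mul_right_cancel₀ hQ h1) (mul_right_cancel₀ hQ₂ h2)

/-- The plane `x^⊥` is the image of the frame map. -/
theorem plane_eq_image (hq : x ⬝ᵥ x ≠ 0) (hQ : w₁ x ω ⬝ᵥ w₁ x ω ≠ 0) :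
    (Finset.univ.filter fun z : V p => z ⬝ᵥ x = 0) = Finset.univ.image (frame x ω) := by
  ext z
  simp only [Finset.mem_filter, Finset.mem_univ, true_and, Finset.mem_image]
  constructor
  · intro hz; exact ⟨_, (expand hq hQ hz).symm⟩
  · rintro ⟨uv, rfl⟩; exact frame_dot_x uv

/-- **Sums over the plane** `x^⊥` are double sums over the frame coordinates. -/
theorem sum_plane (hq : x ⬝ᵥ x ≠ 0) (hQ : w₁ x ω ⬝ᵥ w₁ x ω ≠ 0) (F : V p → ℤ) :
    ∑ z ∈ Finset.univ.filter (fun z : V p => z ⬝ᵥ x = 0), F z =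
      ∑ u : ZMod p, ∑ v : ZMod p, F (u • w₁ x ω + v • w₂ x ω) := by
  rw [plane_eq_image hq hQ, Finset.sum_image fun a _ b _ h => frame_injective hq hQ h,
    ← Finset.univ_product_univ, Finset.sum_product]
  rfl

/-- Dot products of a frame combination: `(u w₁ + v w₂)·y = u (w₁·y) + v (w₂·y)`. -/
theorem comb_dot (u v : ZMod p) (y : V p) :
    (u • w₁ x ω + v • w₂ x ω) ⬝ᵥ y = u * (w₁ x ω ⬝ᵥ y) + v * (w₂ x ω ⬝ᵥ y) := by
  rw [add_dotProduct, smul_dotProduct, smul_dotProduct, smul_eq_mul, smul_eq_mul]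

/-- `Q(u w₁ + v w₂) = u² Q(w₁) + v² Q(w₂)`. -/
theorem comb_dot_self (u v : ZMod p) :
    (u • w₁ x ω + v • w₂ x ω) ⬝ᵥ (u • w₁ x ω + v • w₂ x ω) =
      u ^ 2 * (w₁ x ω ⬝ᵥ w₁ x ω) + v ^ 2 * (w₂ x ω ⬝ᵥ w₂ x ω) := by
  rw [comb_dot, dotProduct_add, dotProduct_smul, dotProduct_smul, dotProduct_add, dotProduct_smul,
    dotProduct_smul, smul_eq_mul, smul_eq_mul, smul_eq_mul, smul_eq_mul, w₁_dot_w₂,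
    dotProduct_comm (w₂ x ω) (w₁ x ω), w₁_dot_w₂]
  ring

end Plane

/-! ## Reflections -/

section Refl

variable {z v x : V p}

/-- `R_z v = v − (2(z·v)/Q z) z`. -/
theorem refl_apply (z v : V p) : reflMat z *ᵥ v = v - ((2 / (z ⬝ᵥ z)) * (z ⬝ᵥ v)) • z := by
  rw [reflMat, Matrix.sub_mulVec, Matrix.one_mulVec, Matrix.vecMulVec_mulVec, op_smul_eq_smul,
    smul_smul, mul_comm]

/-- `(R_z v)·y = v·y − (2(z·v)/Q z)(z·y)`. -/
theorem refl_dot (z v y : V p) :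
    (reflMat z *ᵥ v) ⬝ᵥ y = v ⬝ᵥ y - (2 / (z ⬝ᵥ z)) * (z ⬝ᵥ v) * (z ⬝ᵥ y) := by
  rw [refl_apply, sub_dotProduct, smul_dotProduct, smul_eq_mul]

/-- A reflection in a vector of the plane `x^⊥` preserves the `x`-coordinate. -/
theorem refl_dot_of_perp (hzx : z ⬝ᵥ x = 0) (v : V p) : (reflMat z *ᵥ v) ⬝ᵥ x = v ⬝ᵥ x := by
  rw [refl_dot, hzx, mul_zero, sub_zero]

/-- For an isotropic (or zero) `z` the matrix `reflMat z` acts as the identity (junk value). -/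
theorem refl_apply_of_isotropic (hz : z ⬝ᵥ z = 0) (v : V p) : reflMat z *ᵥ v = v := by
  rw [refl_apply, hz, div_zero, zero_mul, zero_smul, sub_zero]

/-- **Isometry**: `Q(R_z v) = Q(v)`. -/
theorem refl_dot_self (z v : V p) : (reflMat z *ᵥ v) ⬝ᵥ (reflMat z *ᵥ v) = v ⬝ᵥ v := by
  by_cases hz : z ⬝ᵥ z = 0
  · rw [refl_apply_of_isotropic hz]
  · rw [refl_apply]
    simp only [sub_dotProduct, dotProduct_sub, smul_dotProduct, dotProduct_smul, smul_eq_mul,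
      dotProduct_comm v z]
    field_simp
    ring

/-- Scaling the mirror vector does not change the reflection (`s ≠ 0`). -/
theorem refl_smul {s : ZMod p} (hs : s ≠ 0) (z v : V p) :
    reflMat (s • z) *ᵥ v = reflMat z *ᵥ v := by
  by_cases hz : z ⬝ᵥ z = 0
  · rw [refl_apply_of_isotropic hz, refl_apply_of_isotropic]
    rw [smul_dotProduct, dotProduct_smul, smul_eq_mul, smul_eq_mul, hz, mul_zero, mul_zero]
  · rw [refl_apply, refl_apply, smul_dotProduct, dotProduct_smul, smul_dotProduct, smul_eq_mul,
      smul_eq_mul, smul_eq_mul, smul_smul]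
    congr 2
    field_simp

/-- **The pole reflection**: for `ω ≠ X₀` on the sphere `Q = c` (so `Q(ω − X₀) = 2(c − ω·X₀) ≠ 0`)
the reflection in `ω − X₀` maps `ω` to `X₀`. -/
theorem refl_sub_apply (hp2 : p ≠ 2) {c : ZMod p} {ω X₀ : V p} (hω : ω ⬝ᵥ ω = c)
    (hX : X₀ ⬝ᵥ X₀ = c) (ht : ω ⬝ᵥ X₀ ≠ c) : reflMat (ω - X₀) *ᵥ ω = X₀ := by
  have h2 : (2 : ZMod p) ≠ 0 := two_ne_zero_zmod hp2
  have h1 : (ω - X₀) ⬝ᵥ (ω - X₀) = 2 * (c - ω ⬝ᵥ X₀) := by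
    rw [sub_dotProduct, dotProduct_sub, dotProduct_sub, hω, hX, dotProduct_comm X₀ ω]; ring
  have h2 : (ω - X₀) ⬝ᵥ ω = c - ω ⬝ᵥ X₀ := by rw [sub_dotProduct, hω, dotProduct_comm X₀ ω]
  have h3 : c - ω ⬝ᵥ X₀ ≠ 0 := sub_ne_zero.mpr (Ne.symm ht)
  rw [refl_apply, h1, h2, show 2 / (2 * (c - ω ⬝ᵥ X₀)) * (c - ω ⬝ᵥ X₀) = 1 by field_simp,
    one_smul, sub_sub_cancel]

/-- Conversely, `R_z ω = X₀` with `ω ≠ X₀` forces `z ∥ ω − X₀`. -/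
theorem eq_smul_sub_of_refl_eq {ω X₀ : V p} (hne : ω ≠ X₀) (h : reflMat z *ᵥ ω = X₀) :
    ∃ s : ZMod p, s ≠ 0 ∧ z = s • (ω - X₀) := by
  rw [refl_apply] at h
  have hd : ω - X₀ = ((2 / (z ⬝ᵥ z)) * (z ⬝ᵥ ω)) • z := by rw [← h]; abel
  have hl : (2 / (z ⬝ᵥ z)) * (z ⬝ᵥ ω) ≠ 0 := by
    intro h0; apply hne; rw [← sub_eq_zero, hd, h0, zero_smul]
  refine ⟨((2 / (z ⬝ᵥ z)) * (z ⬝ᵥ ω))⁻¹, inv_ne_zero hl, ?_⟩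
  rw [hd, smul_smul, inv_mul_cancel₀ hl, one_smul]

/-- `R_z ω = ω` iff `z ⊥ ω` (for `Q z ≠ 0`, `p ≠ 2`). -/
theorem refl_eq_self_iff (hp2 : p ≠ 2) {ω : V p} (hz : z ⬝ᵥ z ≠ 0) :
    reflMat z *ᵥ ω = ω ↔ z ⬝ᵥ ω = 0 := by
  have hz0 : z ≠ 0 := by rintro rfl; exact hz (dotProduct_zero 0)
  rw [refl_apply, sub_eq_self, smul_eq_zero, or_iff_left hz0, mul_eq_zero,
    or_iff_right (div_ne_zero (two_ne_zero_zmod hp2) hz)]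

end Refl

end ReflectionClassPlane
end Summit.MatrixMultiplication.MatrixMultiplication.Theorems.SubgroupIdentityDesigns.Negative
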